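import Summits.Parity.BatemanHorn.Theses.SelbergLift
import Summits.Parity.BatemanHorn.Theorems.IsogenyRedeiLambdaToCount
import Literature.NumberTheory.Sieve.AletheiaZomleferFukshanskyGarcia2020Applications
import Literature.NumberTheory.Sieve.ParityWave0

/-!
# Strength certificate for the crux `LambdaTwoLift` (item stmt-Parity-18412, route `SelbergLift`)

Strategist exhibit (unit `cstrat-stmt-Parity-18412-s1`). The crux is typed over ALL Bateman–Horn
systems `f : Fin k → ℤ[X]` and ALL lifted indices `i`. Since the Selberg bracket
`Λ(m) log m + Σ_{a ∣ m} Λ(a) Λ(m/a)` is at most `2 (log m)²`, and `log fᵢ(n) ≪ log x` on `n ≤ x`,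
the asserted asymptotic `Ψ₂ ~ 2 · deg fᵢ · C(f) · x log x` forces the `Λ`-mass of the CO-SYSTEM
`(f_j)_{j ≠ i}` to be `≫ x / log x`; removing proper prime powers (`≪ x^{7/8}` of them, tree lemma
`card_filter_bad_le`) this gives infinitely many `n` with every `f_j(n)` (`j ≠ i`) prime.

Consequences proved here, sorry-free:
* `coMass_lower`      : `LambdaTwoLift → ∀ system, ∀ i, coMass ≫ x / log x` eventually;
* `coPrimes_infinite` : `LambdaTwoLift → ∀ system, ∀ i, {n | ∀ j ≠ i, f_j(n) prime}.Infinite`;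
* `landau_of_lambdaTwoLift`    : `LambdaTwoLift → LandauConjecture`   (system `![X+1, X²+1]`, `i = 0`);
* `twinPrime_of_lambdaTwoLift` : `LambdaTwoLift → TwinPrimeConjecture` (system `![X, X+2, X+6]`, `i = 2`).

So every line / decomposition of this crux has stubs that jointly imply the qualitative
Dickson–Schinzel Hypothesis H for every Bateman–Horn system occurring as a co-system: the crux is
not "short of the summit" in any direction a strategist may exploit without re-typing it (which
only the tenure planner may do). See `STRATEGY-CENSUS.md` next to this file.
-/

namespace Summit.Parity.BatemanHorn.Cruxes.LambdaTwoLift.Strength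

open Filter Finset Asymptotics Polynomial ArithmeticFunction
open scoped Topology
open Literature.NumberTheory.Sieve

/-! ### Pointwise bounds -/

/-- The Selberg bracket is at most `2 (log m)²`. -/
theorem bracket_le (m : ℕ) :
    Λ m * Real.log m + ∑ a ∈ m.divisors, Λ a * Λ (m / a) ≤ 2 * Real.log m ^ 2 := by
  have hlog0 : 0 ≤ Real.log m := Real.log_natCast_nonneg m
  have h1 : Λ m * Real.log m ≤ Real.log m * Real.log m :=
    mul_le_mul_of_nonneg_right vonMangoldt_le_log hlog0
  have h2 : ∑ a ∈ m.divisors, Λ a * Λ (m / a) ≤ ∑ a ∈ m.divisors, Λ a * Real.log m := by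
    refine sum_le_sum fun a _ => mul_le_mul_of_nonneg_left ?_ vonMangoldt_nonneg
    refine vonMangoldt_le_log.trans ?_
    rcases Nat.eq_zero_or_pos (m / a) with h | h
    · rw [h, Nat.cast_zero, Real.log_zero]
      exact hlog0
    · exact Real.log_le_log (by exact_mod_cast h) (by exact_mod_cast Nat.div_le_self m a)
  rw [← sum_mul, vonMangoldt_sum] at h2
  nlinarith [h1, h2]

/-- The Selberg bracket is nonnegative. -/
theorem bracket_nonneg (m : ℕ) :
    0 ≤ Λ m * Real.log m + ∑ a ∈ m.divisors, Λ a * Λ (m / a) :=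
  add_nonneg (mul_nonneg vonMangoldt_nonneg (Real.log_natCast_nonneg m))
    (sum_nonneg fun _ _ => mul_nonneg vonMangoldt_nonneg vonMangoldt_nonneg)

/-- Height bound: `(g(n)).toNat ≤ H · n^{deg g}` for `n ≥ 1`, with some `H ≥ 1`. -/
theorem exists_toNat_eval_le (g : ℤ[X]) (hg : g ≠ 0) :
    ∃ H : ℝ, 1 ≤ H ∧ ∀ n : ℕ, 1 ≤ n →
      (((g.eval (n : ℤ)).toNat : ℕ) : ℝ) ≤ H * (n : ℝ) ^ g.natDegree := by
  refine ⟨∑ j ∈ range (g.natDegree + 1), |((g.coeff j : ℤ) : ℝ)|, ?_, ?_⟩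
  · have hmem : g.natDegree ∈ range (g.natDegree + 1) := by simp
    have h1 : (1 : ℝ) ≤ |((g.coeff g.natDegree : ℤ) : ℝ)| := by
      have hne : g.coeff g.natDegree ≠ 0 := by
        rw [coeff_natDegree]; exact leadingCoeff_ne_zero.mpr hg
      have : (1 : ℤ) ≤ |g.coeff g.natDegree| := Int.one_le_abs hne
      exact_mod_cast this
    exact h1.trans (single_le_sum (f := fun j => |((g.coeff j : ℤ) : ℝ)|)
      (fun j _ => abs_nonneg _) hmem)
  · intro n hn
    have hn1 : (1 : ℝ) ≤ n := by exact_mod_cast hn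
    have hcast : (((g.eval (n : ℤ)).toNat : ℕ) : ℝ) ≤ |((g.eval (n : ℤ) : ℤ) : ℝ)| := by
      have : (((g.eval (n : ℤ)).toNat : ℕ) : ℤ) ≤ |g.eval (n : ℤ)| := by
        rw [Int.toNat_eq_max]; exact max_le (le_abs_self _) (abs_nonneg _)
      exact_mod_cast this
    refine hcast.trans ?_
    rw [eval_eq_sum_range]
    push_cast
    refine (abs_sum_le_sum_abs _ _).trans ?_
    rw [sum_mul]
    refine sum_le_sum fun j hj => ?_
    rw [abs_mul, abs_pow, abs_of_nonneg (by positivity : (0 : ℝ) ≤ n)]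
    have hj' : j ≤ g.natDegree := Nat.lt_succ_iff.mp (mem_range.mp hj)
    exact mul_le_mul_of_nonneg_left (pow_le_pow_right₀ hn1 hj') (abs_nonneg _)

/-- Logarithmic height bound on `1 ≤ n ≤ x`: `log (g(n)).toNat ≤ log H + deg g · log x`. -/
theorem log_toNat_eval_le {g : ℤ[X]} {H : ℝ} (hH : 1 ≤ H)
    (hg : ∀ n : ℕ, 1 ≤ n → (((g.eval (n : ℤ)).toNat : ℕ) : ℝ) ≤ H * (n : ℝ) ^ g.natDegree)
    {n x : ℕ} (hn : 1 ≤ n) (hnx : n ≤ x) :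
    Real.log (((g.eval (n : ℤ)).toNat : ℕ) : ℝ) ≤ Real.log H + g.natDegree * Real.log x := by
  have hx1 : (1 : ℝ) ≤ x := by exact_mod_cast hn.trans hnx
  have hlogx : 0 ≤ Real.log x := Real.log_nonneg hx1
  have hlogH : 0 ≤ Real.log H := Real.log_nonneg hH
  rcases Nat.eq_zero_or_pos ((g.eval (n : ℤ)).toNat) with h0 | hpos
  · rw [h0, Nat.cast_zero, Real.log_zero]
    positivity
  · have hle : (((g.eval (n : ℤ)).toNat : ℕ) : ℝ) ≤ H * (x : ℝ) ^ g.natDegree := by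
      refine (hg n hn).trans (mul_le_mul_of_nonneg_left ?_ (by linarith))
      exact pow_le_pow_left₀ (by positivity) (by exact_mod_cast hnx) _
    calc Real.log (((g.eval (n : ℤ)).toNat : ℕ) : ℝ)
        ≤ Real.log (H * (x : ℝ) ^ g.natDegree) := Real.log_le_log (by exact_mod_cast hpos) hle
      _ = Real.log H + g.natDegree * Real.log x := by
        rw [Real.log_mul (by positivity) (by positivity), Real.log_pow]


/-! ### The two sums of the crux -/

variable {k : ℕ}

/-- The Selberg-weighted sum `Ψ₂` of the crux (left-hand side of `LambdaTwoLift`). -/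
noncomputable def psiTwo (f : Fin k → ℤ[X]) (i : Fin k) (x : ℕ) : ℝ :=
  ∑ n ∈ Finset.Icc 1 x,
    (Λ (((f i).eval (n : ℤ)).toNat) * Real.log (((f i).eval (n : ℤ)).toNat) +
        ∑ a ∈ (((f i).eval (n : ℤ)).toNat).divisors,
          Λ a * Λ ((((f i).eval (n : ℤ)).toNat) / a)) *
      ∏ j ∈ Finset.univ.erase i, Λ (((f j).eval (n : ℤ)).toNat)

/-- `Λ`-mass of the co-system `(f_j)_{j ≠ i}` on `1 ≤ n ≤ x`. -/
noncomputable def coMass (f : Fin k → ℤ[X]) (i : Fin k) (x : ℕ) : ℝ :=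
  ∑ n ∈ Finset.Icc 1 x, ∏ j ∈ Finset.univ.erase i, Λ (((f j).eval (n : ℤ)).toNat)

/-- The crux, restated through `psiTwo` (definitional). -/
theorem lambdaTwoLift_iff :
    Summit.Parity.BatemanHorn.Theses.SelbergLift.LambdaTwoLift ↔
      ∀ (k : ℕ) (f : Fin k → ℤ[X]) (i : Fin k), IsBatemanHornSystem f →
        (psiTwo f i) ~[atTop]
          fun x : ℕ => 2 * ((f i).natDegree : ℝ) * batemanHornConst f * (x : ℝ) * Real.log x :=
  Iff.rfl

theorem coWeight_nonneg (f : Fin k → ℤ[X]) (i : Fin k) (n : ℕ) :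
    0 ≤ ∏ j ∈ Finset.univ.erase i, Λ (((f j).eval (n : ℤ)).toNat) :=
  prod_nonneg fun _ _ => vonMangoldt_nonneg

theorem coMass_nonneg (f : Fin k → ℤ[X]) (i : Fin k) (x : ℕ) : 0 ≤ coMass f i x :=
  sum_nonneg fun n _ => coWeight_nonneg f i n

/-- `Ψ₂(x) ≤ 2 (log H + deg fᵢ · log x)² · coMass(x)`. -/
theorem psiTwo_le {f : Fin k → ℤ[X]} (i : Fin k) {H : ℝ} (hH : 1 ≤ H)
    (hg : ∀ n : ℕ, 1 ≤ n →
      ((((f i).eval (n : ℤ)).toNat : ℕ) : ℝ) ≤ H * (n : ℝ) ^ (f i).natDegree)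
    (x : ℕ) :
    psiTwo f i x ≤ 2 * (Real.log H + (f i).natDegree * Real.log x) ^ 2 * coMass f i x := by
  unfold psiTwo coMass
  rw [mul_sum]
  refine sum_le_sum fun n hn => ?_
  obtain ⟨hn1, hnx⟩ := mem_Icc.mp hn
  have hB := bracket_le (((f i).eval (n : ℤ)).toNat)
  have hL := log_toNat_eval_le hH hg hn1 hnx
  have hlog0 : 0 ≤ Real.log ((((f i).eval (n : ℤ)).toNat : ℕ) : ℝ) := Real.log_natCast_nonneg _
  have hsq : Real.log ((((f i).eval (n : ℤ)).toNat : ℕ) : ℝ) ^ 2 ≤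
      (Real.log H + (f i).natDegree * Real.log x) ^ 2 :=
    pow_le_pow_left₀ hlog0 hL 2
  have hW := coWeight_nonneg f i n
  calc _ ≤ 2 * Real.log ((((f i).eval (n : ℤ)).toNat : ℕ) : ℝ) ^ 2 *
        ∏ j ∈ Finset.univ.erase i, Λ (((f j).eval (n : ℤ)).toNat) :=
        mul_le_mul_of_nonneg_right hB hW
    _ ≤ _ := mul_le_mul_of_nonneg_right (by linarith) hW

/-! ### Consequence 1: the co-system carries `Λ`-mass `≫ x / log x` -/

/-- **Co-system mass.** `LambdaTwoLift` forces `Σ_{n ≤ x} ∏_{j ≠ i} Λ(f_j(n)) ≥ c · x / log x`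
eventually, with `c = C(f) / (8 deg fᵢ) > 0`, for EVERY Bateman–Horn system and lifted index. -/
theorem coMass_lower (h : Summit.Parity.BatemanHorn.Theses.SelbergLift.LambdaTwoLift)
    {f : Fin k → ℤ[X]} (hf : IsBatemanHornSystem f) (i : Fin k) :
    ∃ c : ℝ, 0 < c ∧ ∀ᶠ x : ℕ in atTop, c * (x : ℝ) / Real.log x ≤ coMass f i x := by
  have hC : 0 < batemanHornConst f := (IsBatemanHornSystem.hasBatemanHornConst_holds hf).2
  have hd : 0 < (f i).natDegree := hf.natDegree_pos i
  set C := batemanHornConst f with hCdef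
  set d := (f i).natDegree with hddef
  have hd' : (1 : ℝ) ≤ d := by exact_mod_cast hd
  obtain ⟨H, hH1, hH⟩ := exists_toNat_eval_le (f i) (hf.irreducible i).ne_zero
  have hΨ : (psiTwo f i) ~[atTop] fun x : ℕ => 2 * (d : ℝ) * C * (x : ℝ) * Real.log x :=
    lambdaTwoLift_iff.mp h k f i hf
  -- eventually `Ψ₂(x) ≥ d C x log x`
  have hlow : ∀ᶠ x : ℕ in atTop, (d : ℝ) * C * x * Real.log x ≤ psiTwo f i x := by
    filter_upwards [hΨ.isLittleO.def one_half_pos] with x hx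
    simp only [Pi.sub_apply] at hx
    have hg0 : 0 ≤ 2 * (d : ℝ) * C * x * Real.log x := by
      have : 0 ≤ Real.log (x : ℝ) := Real.log_natCast_nonneg x
      positivity
    rw [Real.norm_eq_abs, Real.norm_eq_abs, abs_of_nonneg hg0] at hx
    linarith [neg_abs_le (psiTwo f i x - 2 * (d : ℝ) * C * x * Real.log x)]
  -- eventually `log H ≤ d log x`
  have hxH : ∀ᶠ x : ℕ in atTop, Real.log H ≤ d * Real.log x := by
    filter_upwards [tendsto_natCast_atTop_atTop.eventually_ge_atTop H] with x hx
    have hlogx : Real.log H ≤ Real.log x := Real.log_le_log (by linarith) hx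
    have h0 : 0 ≤ Real.log (x : ℝ) := Real.log_natCast_nonneg x
    nlinarith
  refine ⟨C / (8 * d), by positivity, ?_⟩
  filter_upwards [hlow, hxH, eventually_ge_atTop 2] with x hlo hxH' hx2
  have hlogx : 0 < Real.log (x : ℝ) := Real.log_pos (by exact_mod_cast hx2)
  have hM0 : 0 ≤ coMass f i x := coMass_nonneg f i x
  have h1 : (d : ℝ) * C * x * Real.log x ≤ 2 * (2 * d * Real.log x) ^ 2 * coMass f i x := by
    refine hlo.trans ((psiTwo_le i hH1 hH x).trans ?_)
    refine mul_le_mul_of_nonneg_right ?_ hM0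
    have hle : Real.log H + d * Real.log x ≤ 2 * d * Real.log x := by linarith
    have h0 : 0 ≤ Real.log H + d * Real.log x := by
      have := Real.log_nonneg hH1
      positivity
    nlinarith [pow_le_pow_left₀ h0 hle 2]
  rw [div_mul_eq_mul_div, div_div, div_le_iff₀ (by positivity)]
  have hdl : 0 < (d : ℝ) * Real.log x := by positivity
  have h2 : (d * Real.log x) * (C * x) ≤ (d * Real.log x) * (coMass f i x * (8 * d * Real.log x)) := by
    have e1 : (d * Real.log x) * (C * x) = (d : ℝ) * C * x * Real.log x := by ring
    have e2 : (d * Real.log x) * (coMass f i x * (8 * d * Real.log x)) =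
        2 * (2 * d * Real.log x) ^ 2 * coMass f i x := by ring
    rw [e1, e2]
    exact h1
  exact le_of_mul_le_mul_left h2 hdl

/-- The co-system mass tends to infinity. -/
theorem tendsto_coMass (h : Summit.Parity.BatemanHorn.Theses.SelbergLift.LambdaTwoLift)
    {f : Fin k → ℤ[X]} (hf : IsBatemanHornSystem f) (i : Fin k) :
    Tendsto (coMass f i) atTop atTop := by
  obtain ⟨c, hc, hev⟩ := coMass_lower h hf i
  have ht : Tendsto (fun x : ℕ => c * ((x : ℝ) / Real.log x)) atTop atTop :=
    Tendsto.const_mul_atTop hc tendsto_natCast_div_log_atTop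
  refine tendsto_atTop_mono' atTop ?_ ht
  filter_upwards [hev] with x hx
  rwa [← mul_div_assoc]

/-! ### Consequence 2: infinitely many co-system prime tuples (Hypothesis H for the co-system) -/

/-- If a `Λ`-product over a finset is nonzero and not all entries are prime, one entry is a proper
prime power. -/
theorem exists_eq_prime_pow_of_prod_ne_zero {ι : Type*} (s : Finset ι) (m : ι → ℕ)
    (h0 : ∏ j ∈ s, Λ (m j) ≠ 0) (h : ¬∀ j ∈ s, (m j).Prime) :
    ∃ j ∈ s, ∃ p a : ℕ, p.Prime ∧ 2 ≤ a ∧ m j = p ^ a := by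
  push Not at h
  obtain ⟨j, hj, hnp⟩ := h
  have hne : Λ (m j) ≠ 0 := (prod_ne_zero_iff.mp h0) j hj
  rw [vonMangoldt_ne_zero_iff] at hne
  obtain ⟨p, a, hp, ha, hpa⟩ := (isPrimePow_nat_iff _).mp hne
  refine ⟨j, hj, p, a, hp, ?_, hpa.symm⟩
  by_contra hlt
  have : a = 1 := by omega
  subst this
  rw [pow_one] at hpa
  exact hnp (hpa ▸ hp)

/-- **Hypothesis H for the co-system.** `LambdaTwoLift` implies that for EVERY Bateman–Horn system
`f` and EVERY index `i`, infinitely many `n` make all `f_j(n)`, `j ≠ i`, simultaneously prime. -/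
theorem coPrimes_infinite (h : Summit.Parity.BatemanHorn.Theses.SelbergLift.LambdaTwoLift)
    {f : Fin k → ℤ[X]} (hf : IsBatemanHornSystem f) (i : Fin k) :
    {n : ℕ | ∀ j, j ≠ i → (((f j).eval (n : ℤ)).toNat).Prime}.Infinite := by
  classical
  -- notation
  set m : Fin k → ℕ → ℕ := fun j n => ((f j).eval (n : ℤ)).toNat with hmdef
  set W : ℕ → ℝ := fun n => ∏ j ∈ Finset.univ.erase i, Λ (m j n) with hWdef
  have hWM : ∀ x, coMass f i x = ∑ n ∈ Icc 1 x, W n := fun x => rfl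
  -- heights of all members
  have hHt : ∀ j, ∃ H : ℝ, 1 ≤ H ∧ ∀ n : ℕ, 1 ≤ n →
      (((f j).eval (n : ℤ)).toNat : ℝ) ≤ H * (n : ℝ) ^ (f j).natDegree :=
    fun j => exists_toNat_eval_le (f j) (hf.irreducible j).ne_zero
  choose H hH1 hH using hHt
  set D : ℝ := 1 + ∑ j, ((f j).natDegree : ℝ) with hDdef
  have hD1 : (1 : ℝ) ≤ D := by
    have : 0 ≤ ∑ j, ((f j).natDegree : ℝ) := sum_nonneg fun _ _ => by positivity
    linarith
  have hDj : ∀ j, 1 + ((f j).natDegree : ℝ) ≤ D := fun j => by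
    have := single_le_sum (f := fun j => ((f j).natDegree : ℝ)) (fun _ _ => by positivity)
      (mem_univ j)
    simpa [hDdef] using this
  set r : ℕ := (Finset.univ.erase i).card with hrdef
  -- eventually `x ≥ H j` for all `j`
  have hxH : ∀ᶠ x : ℕ in atTop, ∀ j, Real.log (H j) ≤ Real.log x := by
    refine eventually_all.mpr fun j => ?_
    filter_upwards [tendsto_natCast_atTop_atTop.eventually_ge_atTop (H j)] with x hx
    exact Real.log_le_log (by linarith [hH1 j]) hx
  -- pointwise weight bound `W n ≤ (D log x)^r` on `1 ≤ n ≤ x` once `x ≥ max H j`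
  have hWle : ∀ x : ℕ, (∀ j, Real.log (H j) ≤ Real.log x) → ∀ n ∈ Icc 1 x,
      W n ≤ (D * Real.log x) ^ r := by
    intro x hx n hn
    obtain ⟨hn1, hnx⟩ := mem_Icc.mp hn
    have hlogx : 0 ≤ Real.log (x : ℝ) := Real.log_natCast_nonneg x
    have hterm : ∀ j ∈ Finset.univ.erase i, Λ (m j n) ≤ D * Real.log x := by
      intro j _
      calc Λ (m j n) ≤ Real.log (m j n) := vonMangoldt_le_log
        _ ≤ Real.log (H j) + (f j).natDegree * Real.log x := log_toNat_eval_le (hH1 j) (hH j) hn1 hnx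
        _ ≤ Real.log x + (f j).natDegree * Real.log x := by linarith [hx j]
        _ = (1 + (f j).natDegree) * Real.log x := by ring
        _ ≤ D * Real.log x := mul_le_mul_of_nonneg_right (hDj j) hlogx
    calc W n = ∏ j ∈ Finset.univ.erase i, Λ (m j n) := rfl
      _ ≤ ∏ j ∈ Finset.univ.erase i, D * Real.log x :=
          prod_le_prod (fun _ _ => vonMangoldt_nonneg) hterm
      _ = (D * Real.log x) ^ r := by rw [prod_const]
  -- the finitely many good `n` (by contradiction) and the bad `n`
  by_contra hfin
  rw [Set.not_infinite] at hfin
  set N₀ : ℕ := hfin.toFinset.card with hN₀def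
  obtain ⟨K, hK⟩ := Summit.Parity.BatemanHorn.LambdaToCount.card_filter_bad_le hf
  obtain ⟨c, hc, hlow⟩ := coMass_lower h hf i
  -- the support of `W` inside `Icc 1 x` has at most `N₀ + K x^{7/8}` elements
  have hsupp : ∀ x : ℕ, 1 ≤ x →
      (#((Icc 1 x).filter fun n => W n ≠ 0) : ℝ) ≤ N₀ + K * (x : ℝ) ^ (7 / 8 : ℝ) := by
    intro x hx
    have hsub : ((Icc 1 x).filter fun n => W n ≠ 0) ⊆
        hfin.toFinset ∪ ((Icc 1 x).filter fun n : ℕ => ∃ i, ∃ p a : ℕ, p.Prime ∧ 2 ≤ a ∧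
          ((f i).eval (n : ℤ)).toNat = p ^ a) := by
      intro n hn
      rw [mem_filter] at hn
      obtain ⟨hnI, hWn⟩ := hn
      rw [mem_union]
      by_cases hall : ∀ j ∈ Finset.univ.erase i, (m j n).Prime
      · left
        rw [Set.Finite.mem_toFinset]
        intro j hj
        exact hall j (mem_erase.mpr ⟨hj, mem_univ j⟩)
      · right
        obtain ⟨j, -, p, a, hp, ha, hpa⟩ := exists_eq_prime_pow_of_prod_ne_zero _ _ hWn hall
        exact mem_filter.mpr ⟨hnI, j, p, a, hp, ha, hpa⟩
    calc (#((Icc 1 x).filter fun n => W n ≠ 0) : ℝ)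
        ≤ (#(hfin.toFinset ∪ ((Icc 1 x).filter fun n : ℕ => ∃ i, ∃ p a : ℕ, p.Prime ∧ 2 ≤ a ∧
            ((f i).eval (n : ℤ)).toNat = p ^ a)) : ℝ) := by exact_mod_cast card_le_card hsub
      _ ≤ (N₀ : ℝ) + #((Icc 1 x).filter fun n : ℕ => ∃ i, ∃ p a : ℕ, p.Prime ∧ 2 ≤ a ∧
            ((f i).eval (n : ℤ)).toNat = p ^ a) := by exact_mod_cast card_union_le _ _
      _ ≤ N₀ + K * (x : ℝ) ^ (7 / 8 : ℝ) := by linarith [hK x hx]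
  -- hence `coMass x ≤ (N₀ + K x^{7/8}) (D log x)^r`
  have hup : ∀ᶠ x : ℕ in atTop, coMass f i x ≤ (N₀ + K * (x : ℝ) ^ (7 / 8 : ℝ)) * (D * Real.log x) ^ r := by
    filter_upwards [hxH, eventually_ge_atTop 1] with x hx hx1
    have hLr : 0 ≤ (D * Real.log x) ^ r := by
      have : 0 ≤ Real.log (x : ℝ) := Real.log_natCast_nonneg x
      positivity
    calc coMass f i x = ∑ n ∈ Icc 1 x, W n := hWM x
      _ = ∑ n ∈ (Icc 1 x).filter (fun n => W n ≠ 0), W n := (sum_filter_ne_zero _).symm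
      _ ≤ #((Icc 1 x).filter fun n => W n ≠ 0) • (D * Real.log x) ^ r :=
          sum_le_card_nsmul _ _ _ fun n hn => hWle x hx n (mem_filter.mp hn).1
      _ = (#((Icc 1 x).filter fun n => W n ≠ 0) : ℝ) * (D * Real.log x) ^ r := nsmul_eq_mul _ _
      _ ≤ (N₀ + K * (x : ℝ) ^ (7 / 8 : ℝ)) * (D * Real.log x) ^ r :=
          mul_le_mul_of_nonneg_right (hsupp x hx1) hLr
  -- but `(N₀ + K x^{7/8}) (D log x)^r · log x = o(x)`
  set A : ℝ := ((N₀ : ℝ) + max K 1) * D ^ r with hAdef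
  have hA0 : 0 < A := by
    have : (0 : ℝ) < max K 1 := lt_max_of_lt_right one_pos
    positivity
  have hsmall : ∀ᶠ x : ℕ in atTop,
      A * (Real.log x ^ (r + 1) * (x : ℝ) ^ (7 / 8 : ℝ)) ≤ c / 2 * (x : ℝ) := by
    have hlo := (Summit.Parity.BatemanHorn.LambdaToCount.isLittleO_log_pow_mul_rpow
      (show (7 / 8 : ℝ) < 1 by norm_num) (r + 1)).const_mul_left A
    filter_upwards [hlo.def (half_pos hc), eventually_ge_atTop 1] with x hx hx1
    have hxpos : (0 : ℝ) < x := by exact_mod_cast hx1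
    have hlogx : 0 ≤ Real.log (x : ℝ) := Real.log_natCast_nonneg x
    rw [Real.norm_eq_abs, Real.norm_eq_abs, Real.rpow_one, abs_of_nonneg (by positivity),
      abs_of_nonneg hxpos.le] at hx
    exact hx
  obtain ⟨x, hx⟩ := (hlow.and (hup.and (hsmall.and (eventually_ge_atTop 2)))).exists
  obtain ⟨hlo, hupx, hsm, hx2⟩ := hx
  have hxpos : (0 : ℝ) < x := by exact_mod_cast (show 0 < x by omega)
  have hx1 : (1 : ℝ) ≤ x := by exact_mod_cast (show 1 ≤ x by omega)
  have hlogx : 0 < Real.log (x : ℝ) := Real.log_pos (by exact_mod_cast hx2)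
  have hx78 : (1 : ℝ) ≤ (x : ℝ) ^ (7 / 8 : ℝ) := Real.one_le_rpow hx1 (by norm_num)
  -- `N₀ + K x^{7/8} ≤ (N₀ + max K 1) x^{7/8}`
  have hNK : (N₀ : ℝ) + K * (x : ℝ) ^ (7 / 8 : ℝ) ≤ ((N₀ : ℝ) + max K 1) * (x : ℝ) ^ (7 / 8 : ℝ) := by
    have h1 : (N₀ : ℝ) ≤ N₀ * (x : ℝ) ^ (7 / 8 : ℝ) := by
      have := mul_le_mul_of_nonneg_left hx78 (Nat.cast_nonneg N₀); simpa using this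
    have h2 : K * (x : ℝ) ^ (7 / 8 : ℝ) ≤ max K 1 * (x : ℝ) ^ (7 / 8 : ℝ) :=
      mul_le_mul_of_nonneg_right (le_max_left _ _) (by positivity)
    nlinarith
  -- chain
  have hchain : c * (x : ℝ) / Real.log x ≤ A * (Real.log x ^ r * (x : ℝ) ^ (7 / 8 : ℝ)) := by
    refine hlo.trans (hupx.trans ?_)
    have hLr : 0 ≤ (D * Real.log x) ^ r := by positivity
    calc (N₀ + K * (x : ℝ) ^ (7 / 8 : ℝ)) * (D * Real.log x) ^ r
        ≤ (((N₀ : ℝ) + max K 1) * (x : ℝ) ^ (7 / 8 : ℝ)) * (D * Real.log x) ^ r :=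
          mul_le_mul_of_nonneg_right hNK hLr
      _ = A * (Real.log x ^ r * (x : ℝ) ^ (7 / 8 : ℝ)) := by rw [hAdef, mul_pow]; ring
  have hmul : c * (x : ℝ) ≤ A * (Real.log x ^ (r + 1) * (x : ℝ) ^ (7 / 8 : ℝ)) := by
    rw [div_le_iff₀ hlogx] at hchain
    calc c * (x : ℝ) ≤ A * (Real.log x ^ r * (x : ℝ) ^ (7 / 8 : ℝ)) * Real.log x := hchain
      _ = A * (Real.log x ^ (r + 1) * (x : ℝ) ^ (7 / 8 : ℝ)) := by ring
  have : c * (x : ℝ) ≤ c / 2 * (x : ℝ) := hmul.trans hsm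
  nlinarith

/-! ### Consequence 3: Landau's conjecture and the twin prime conjecture -/

/-- Non-association from a separating evaluation point. -/
theorem not_associated_of_eval {p q : ℤ[X]} (t : ℤ) (hp : p.eval t = 0) (hq : q.eval t ≠ 0) :
    ¬Associated p q := fun h => hq (zero_dvd_iff.mp (hp ▸ eval_dvd h.dvd))

/-- The system `(X + 1, X² + 1)` is a Bateman–Horn system. -/
theorem isBatemanHornSystem_landauPair : IsBatemanHornSystem ![(X + 1 : ℤ[X]), X ^ 2 + 1] where
  irreducible i := by
    fin_cases i
    · simpa using irreducible_X_sub_C (-1 : ℤ)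
    · simpa using irreducible_X_sq_add_one_int
  leadingCoeff_pos i := by
    fin_cases i
    · show 0 < ((X : ℤ[X]) + 1).leadingCoeff
      rw [show ((X : ℤ[X]) + 1) = X + Polynomial.C 1 by simp, (monic_X_add_C (1 : ℤ)).leadingCoeff]
      exact one_pos
    · show 0 < ((X : ℤ[X]) ^ 2 + 1).leadingCoeff
      rw [show ((X : ℤ[X]) ^ 2 + 1) = X ^ 2 + Polynomial.C 1 by simp,
        (monic_X_pow_add_C (1 : ℤ) two_ne_zero).leadingCoeff]
      exact one_pos
  pairwise_not_associated := by
    have key : ¬Associated (X + 1 : ℤ[X]) (X ^ 2 + 1) :=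
      not_associated_of_eval (-1) (by simp) (by norm_num)
    intro i j hij
    fin_cases i <;> fin_cases j
    · exact absurd rfl hij
    · simpa using key
    · simpa using fun h => key h.symm
    · exact absurd rfl hij
  hasNoFixedPrimeDivisor := (hasNoFixedPrimeDivisor_iff_forall_exists_not_dvd _).mpr fun p hp => by
    refine ⟨0, ?_⟩
    simp only [Fin.prod_univ_two, Matrix.cons_val_zero, Matrix.cons_val_one,
      eval_add, eval_X, eval_pow, eval_one]
    norm_num
    intro hdvd
    have h1 : (p : ℤ) ≤ 1 := Int.le_of_dvd one_pos hdvd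
    have h2 := hp.two_le
    omega

/-- The system `(X, X + 2, X + 6)` is a Bateman–Horn system. -/
theorem isBatemanHornSystem_twinTriple :
    IsBatemanHornSystem ![(X : ℤ[X]), X + Polynomial.C 2, X + Polynomial.C 6] where
  irreducible i := by
    fin_cases i
    · exact prime_X.irreducible
    · simpa using irreducible_X_sub_C (-2 : ℤ)
    · simpa using irreducible_X_sub_C (-6 : ℤ)
  leadingCoeff_pos i := by
    fin_cases i
    · simp
    · show 0 < ((X : ℤ[X]) + Polynomial.C 2).leadingCoeff
      rw [(monic_X_add_C (2 : ℤ)).leadingCoeff]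
      exact one_pos
    · show 0 < ((X : ℤ[X]) + Polynomial.C 6).leadingCoeff
      rw [(monic_X_add_C (6 : ℤ)).leadingCoeff]
      exact one_pos
  pairwise_not_associated := by
    have k01 : ¬Associated (X : ℤ[X]) (X + Polynomial.C 2) :=
      not_associated_of_eval 0 (by simp) (by simp)
    have k02 : ¬Associated (X : ℤ[X]) (X + Polynomial.C 6) :=
      not_associated_of_eval 0 (by simp) (by simp)
    have k12 : ¬Associated (X + Polynomial.C 2 : ℤ[X]) (X + Polynomial.C 6) :=
      not_associated_of_eval (-2) (by simp) (by simp)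
    intro i j hij
    fin_cases i <;> fin_cases j
    · exact absurd rfl hij
    · simpa using k01
    · simpa using k02
    · simpa using fun h => k01 h.symm
    · exact absurd rfl hij
    · simpa using k12
    · simpa using fun h => k02 h.symm
    · simpa using fun h => k12 h.symm
    · exact absurd rfl hij
  hasNoFixedPrimeDivisor := (hasNoFixedPrimeDivisor_iff_forall_exists_not_dvd _).mpr fun p hp => by
    by_cases hp2 : p = 2
    · subst hp2
      refine ⟨1, ?_⟩
      simp only [Fin.prod_univ_three, Matrix.cons_val_zero, Matrix.cons_val_one, Matrix.cons_val_two,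
        Matrix.head_cons, Matrix.tail_cons, eval_add, eval_X, eval_C]
      decide
    · refine ⟨2, ?_⟩
      simp only [Fin.prod_univ_three, Matrix.cons_val_zero, Matrix.cons_val_one, Matrix.cons_val_two,
        Matrix.head_cons, Matrix.tail_cons, eval_add, eval_X, eval_C]
      norm_num
      intro hdvd
      have h64 : p ∣ 2 ^ 6 := by exact_mod_cast hdvd
      exact hp2 ((Nat.prime_dvd_prime_iff_eq hp Nat.prime_two).mp (hp.dvd_of_dvd_pow h64))

/-- **`LambdaTwoLift ⟹ Landau's conjecture`** (lift `X + 1` against the co-system `X² + 1`). -/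
theorem landau_of_lambdaTwoLift (h : Summit.Parity.BatemanHorn.Theses.SelbergLift.LambdaTwoLift) :
    LandauConjecture := by
  have hinf := coPrimes_infinite h isBatemanHornSystem_landauPair 0
  refine Set.Infinite.mono (fun n hn => ?_) hinf
  have h1 := hn 1 (by decide)
  simp only [Matrix.cons_val_one, Matrix.cons_val_fin_one, eval_add, eval_pow, eval_X, eval_one] at h1
  have hcast : ((n : ℤ) ^ 2 + 1).toNat = n ^ 2 + 1 := by
    rw [show ((n : ℤ) ^ 2 + 1) = ((n ^ 2 + 1 : ℕ) : ℤ) by push_cast; ring, Int.toNat_natCast]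
  simpa [hcast] using h1

/-- **`LambdaTwoLift ⟹ the twin prime conjecture`** (lift `X + 6` against the co-system
`(X, X + 2)`). -/
theorem twinPrime_of_lambdaTwoLift (h : Summit.Parity.BatemanHorn.Theses.SelbergLift.LambdaTwoLift) :
    TwinPrimeConjecture := by
  have hinf := coPrimes_infinite h isBatemanHornSystem_twinTriple 2
  intro N
  obtain ⟨n, hn, hNn⟩ := hinf.exists_gt N
  have h0 := hn 0 (by decide)
  have h1 := hn 1 (by decide)
  simp only [Matrix.cons_val_zero, eval_X, Int.toNat_natCast] at h0
  simp only [Matrix.cons_val_one, Matrix.cons_val_zero, eval_add, eval_X, eval_C] at h1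
  have hcast : ((n : ℤ) + 2).toNat = n + 2 := by
    rw [show ((n : ℤ) + 2) = ((n + 2 : ℕ) : ℤ) by push_cast; ring, Int.toNat_natCast]
  rw [hcast] at h1
  exact ⟨n, hNn, h0, h1⟩

end Summit.Parity.BatemanHorn.Cruxes.LambdaTwoLift.Strength
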